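import Mathlib
import Summits.ValiantsHypothesis.ValiantsHypothesis.Theorems.GeneratorObstructionsGenFlipThesisGammaEquality
import Summits.ValiantsHypothesis.ValiantsHypothesis.Theorems.GeneratorObstructionsPowGenDegreeQPWideRegime

/-!
# K2 `PowGenDegreeQP` (stmt-ValiantsHypothesis-11655), line `trace-side-regimes`:
# inheritance of generator types is EXACT AND EXHAUSTIVE — generator flips live on slice weights

Helper file (`--supports stmt-ValiantsHypothesis-11655`).  The registered skeleton
`Cruxes/GenFlipThesis/Lines/trace_side_regimes.lean` splits K2 by the support of the weight:
`stub_sliceGen` (weights `ext_ι χ` supported on the final `m²` letters) and `stub_wideGen` (a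
nonzero entry off them), and its card says the wide half is "route-irrelevant".  This file makes
that precise BY NAME and completes the tree's inheritance theorems
(`GenInheritanceUpper.finrank_ne_zero_rename_of_strictMono`: generator types go UP along a
placement of letters; `GammaEquality.finrank_rename_eq_of_injective`: with the same count) by the
missing EXHAUSTIVENESS half:

* `symm_add_card_lt_of_not_mem_range` — a letter off a final segment `ι : σ → τ` is among the
  bottom `|τ| - |σ|` letters (counting in a finite linear order);
* `extend_comp_eq_of_hasHighestWeight_rename` — for an injection `κ : σ → τ` and ANY form `f` in
  the letters `σ`, every weight `ψ` of `GL_τ` occurring in `ℂ[Δ_m(rename κ f)]` is supported on the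
  final segment: `ψ = ext_ι (ψ ∘ ι)` (Bürgisser–Ikenmeyer–Panova 2019 Thm. 4.9(1) in weight form,
  tree `apply_eq_zero_of_hasHighestWeight_orbitCoordRep_of_vars_subset`, `ℓ(λ) ≤ |σ|`);
* `finrank_ne_zero_rename_iff` — **two-sided inheritance of generator types**: for a nonzero form
  `f` of degree `m`, `γ_ψ(rename κ f) ≠ 0 ⟺ ψ = ext_ι(ψ ∘ ι) ∧ γ_{ψ∘ι}(f) ≠ 0`; so the generator
  types of a placed form are EXACTLY the extended generator types of the form in its own letters,
  with the same counts and degrees (`size_extend`);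
* `blockPer_genType_iff` — the case of the route's block permanent: generator types of
  `A(Δ_m[per_m on the top-left block of the (m+e)×(m+e) matrix])` are exactly `ext_ι χ`, `χ` a
  generator type of `A(Δ_m[per_m])` in its own `m²` letters;
* `genFlipThesis_iff_ownFlip` — hence the route's deciding crux `GenFlipThesis`
  (stmt-ValiantsHypothesis-11653, verbatim) is EQUIVALENT to the own-variables flip statement of
  `GammaEquality.genFlipThesis_of_ownFlip`: a flip `γ_ψ(tr X_n^m) < γ_ψ(per_m)` forces `γ_ψ(per_m) ≠ 0`,
  hence `ψ` is a slice weight.  NO generator flip can sit at a wide weight: the wide half of K2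
  (`stub_wideGen`) is not only unused by the glue (`slice_overflow`) but unusable by ANY flip — the
  part of K2 = `PowGenDegreeQP` beyond `stub_sliceGen` is dead weight for the thesis, by name.

Honest framing: structure only (equivalences and one application); `stub_sliceGen`,
`stub_wideGen`, K1, K2, `GenFlipThesis` remain OPEN; `VP ≠ VNP` is not touched.

References: Bürgisser–Ikenmeyer–Panova, J. AMS 32 (2019) Thm. 4.9(1); Bürgisser–Landsberg–
Manivel–Weyman, SIAM J. Comput. 40 (2011) §5.4; Landsberg, *Geometry and Complexity Theory*
(2017) §8.4.1 (inheritance).  No new definitions.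
-/

namespace Summit.ValiantsHypothesis.ValiantsHypothesis.Theorems.GenInheritance

open MvPolynomial
open Literature.NumberTheory.DiophantineGeometry Literature.Computability.AlgebraicComplexity
open Summit.ValiantsHypothesis.ValiantsHypothesis.Theses.GeneratorObstructions
open Summit.ValiantsHypothesis.ValiantsHypothesis.Theorems.GeneratorObstructions.SliceTransfer
open Summit.ValiantsHypothesis.ValiantsHypothesis.Theorems.GeneratorObstructions.GammaEquality
open Summit.ValiantsHypothesis.ValiantsHypothesis.Theorems.GeneratorObstructions.PowGenDegreeQP

-- `Summit.ValiantsHypothesis.ValiantsHypothesis.…` is the tree's mandated single-conjunct layout.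
set_option linter.dupNamespace false

noncomputable section

/-! ## 1. Letters off a final segment are low -/

section Index

variable {σ τ : Type} [Fintype σ] [LinearOrder σ] [Fintype τ] [LinearOrder τ]

/-- **Off a final segment one is among the bottom `|τ| - |σ|` letters.**  If `ι : σ → τ` is strictly
monotone onto an upper set, `e : Fin N ≃o τ` enumerates `τ` increasingly and `x ∉ range ι`, then
`e⁻¹(x) + |σ| < N`: the `|σ|` letters of `range ι` all lie strictly above `x`. [folklore] -/
theorem symm_add_card_lt_of_not_mem_range {N : ℕ} (e : Fin N ≃o τ) {ι : σ → τ} (hι : StrictMono ι)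
    (hup : IsUpperSet (Set.range ι)) {x : τ} (hx : x ∉ Set.range ι) :
    ((e.symm x : Fin N) : ℕ) + Fintype.card σ < N := by
  have hsub : Set.range ι ⊆ Set.Ioi x := by
    intro y hy
    rcases lt_or_ge x y with h | h
    · exact h
    · exact absurd (hup h hy) hx
  have h1 : (Set.range ι).ncard = Fintype.card σ := by
    rw [Set.ncard_range_of_injective hι.injective, Nat.card_eq_fintype_card]
  have h2 : (Set.Ioi x).ncard = N - 1 - ((e.symm x : Fin N) : ℕ) := by
    have hIoi : Set.Ioi x = e '' Set.Ioi (e.symm x) := by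
      rw [OrderIso.image_Ioi, OrderIso.apply_symm_apply]
    rw [hIoi, Set.ncard_image_of_injective _ e.injective, ← Finset.coe_Ioi, Set.ncard_coe_finset,
      Fin.card_Ioi]
  have h3 := Set.ncard_le_ncard hsub (Set.toFinite _)
  have h4 := (e.symm x).2
  omega

end Index

/-! ## 2. Occurring weights of a placed form are supported on the final segment -/

section Support

variable {σ τ : Type} [Fintype σ] [LinearOrder σ] [Fintype τ] [LinearOrder τ]

/-- **Exhaustiveness of inheritance (BIP 2019 Thm. 4.9(1) in weight form).**  For an injection of
letters `κ : σ → τ`, the final segment `ι : σ → τ` and any form `f` in the letters `σ`: a weight `ψ`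
of `GL_τ` occurring in `ℂ[Δ_m(rename κ f)]` vanishes off `range ι`, i.e. `ψ = ext_ι (ψ ∘ ι)`
(`ℓ(λ) ≤ |σ|` for `ψ = λ*`).  The placed form uses only the `|σ|` letters `range κ`
(`vars_rename`), so the tree's `apply_eq_zero_of_hasHighestWeight_orbitCoordRep_of_vars_subset`
kills `ψ` on the bottom `|τ| - |σ|` letters, which by `symm_add_card_lt_of_not_mem_range` are
exactly the letters off the final segment. [cite: BurgisserIkenmeyerPanovaJAMS2019, Thm. 4.9(1)] -/
theorem extend_comp_eq_of_hasHighestWeight_rename {κ : σ → τ} (hκ : Function.Injective κ)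
    {ι : σ → τ} (hι : StrictMono ι) (hup : IsUpperSet (Set.range ι)) {f : MvPolynomial σ ℂ} {m : ℕ}
    {ψ : Weight τ} (hψ : HasHighestWeight (orbitCoordRep (rename κ f) m) ψ) :
    Function.extend ι (ψ ∘ ι) 0 = ψ := by
  classical
  funext x
  by_cases hx : ∃ j, ι j = x
  · obtain ⟨j, rfl⟩ := hx
    rw [hι.injective.extend_apply, Function.comp_apply]
  · rw [Function.extend_apply' _ _ _ hx, Pi.zero_apply]
    have hx' : x ∉ Set.range ι := fun ⟨j, hj⟩ => hx ⟨j, hj⟩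
    have hlt := symm_add_card_lt_of_not_mem_range (Fintype.orderIsoFinOfCardEq τ rfl) hι hup hx'
    have hcard : (Finset.univ.image κ).card = Fintype.card σ := by
      rw [Finset.card_image_of_injective _ hκ, Finset.card_univ]
    have hvars : (↑(rename κ f).vars : Set τ) ⊆ ↑(Finset.univ.image κ) := by
      intro y hy
      have h1 := vars_rename κ f (Finset.mem_coe.mp hy)
      rw [Finset.mem_coe, Finset.mem_image]
      obtain ⟨a, -, ha⟩ := Finset.mem_image.mp h1
      exact ⟨a, Finset.mem_univ _, ha⟩
    have h := apply_eq_zero_of_hasHighestWeight_orbitCoordRep_of_vars_subset (m := m)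
      (Fintype.orderIsoFinOfCardEq τ rfl) (rename κ f) (Finset.univ.image κ) hvars hψ
      ((Fintype.orderIsoFinOfCardEq τ rfl).symm x) (by rw [hcard]; exact hlt)
    rw [OrderIso.apply_symm_apply] at h
    exact h.symm

/-- Degrees are inherited: an occurring weight of a placed form has the size of its restriction to
the final segment. [folklore] -/
theorem size_comp_eq_of_hasHighestWeight_rename {κ : σ → τ} (hκ : Function.Injective κ)
    {ι : σ → τ} (hι : StrictMono ι) (hup : IsUpperSet (Set.range ι)) {f : MvPolynomial σ ℂ} {m : ℕ}
    {ψ : Weight τ} (hψ : HasHighestWeight (orbitCoordRep (rename κ f) m) ψ) :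
    Weight.size (ψ ∘ ι) = Weight.size ψ := by
  conv_rhs => rw [← extend_comp_eq_of_hasHighestWeight_rename hκ hι hup hψ]
  exact (size_extend hι.injective (ψ ∘ ι)).symm

end Support

/-! ## 3. Two-sided inheritance of generator types -/

section TwoSided

variable {σ τ : Type} [Fintype σ] [LinearOrder σ] [Fintype τ] [LinearOrder τ]

/-- **Two-sided inheritance of generator types.**  For an injection of letters `κ : σ → τ`, the
final segment `ι : σ → τ`, a nonzero form `f` of degree `m` in the letters `σ` and ANY weight `ψ` of
`GL_τ`: `ψ` is a generator type of `A(Δ_m(rename κ f))` (`γ_ψ ≠ 0`) iff `ψ` is supported on the final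
segment, `ψ = ext_ι(ψ ∘ ι)`, and its restriction `ψ ∘ ι` is a generator type of `A(Δ_m f)` — and then
the two generator counts agree (`GammaEquality.finrank_rename_eq_of_injective`).  Upward half:
BLMW 2011 §5.4 (tree `GenInheritanceUpper`); exhaustiveness: BIP 2019 Thm. 4.9(1)
(`extend_comp_eq_of_hasHighestWeight_rename`). [folklore] -/
theorem finrank_ne_zero_rename_iff {κ : σ → τ} (hκ : Function.Injective κ)
    {ι : σ → τ} (hι : StrictMono ι) (hup : IsUpperSet (Set.range ι)) {f : MvPolynomial σ ℂ} {m : ℕ}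
    (hf : f.IsHomogeneous m) (hf0 : f ≠ 0) (ψ : Weight τ) :
    Module.finrank ℂ (↥(highestWeightSpace (orbitCoordRep (rename κ f) m) ψ) ⧸
      Submodule.comap (highestWeightSpace (orbitCoordRep (rename κ f) m) ψ).subtype
        (⨆ p : Weight τ × Weight τ, ⨆ (_ : p.1 + p.2 = ψ ∧ p.1 ≠ 0 ∧ p.2 ≠ 0),
          highestWeightSpace (orbitCoordRep (rename κ f) m) p.1 *
            highestWeightSpace (orbitCoordRep (rename κ f) m) p.2)) ≠ 0 ↔
    Function.extend ι (ψ ∘ ι) 0 = ψ ∧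
    Module.finrank ℂ (↥(highestWeightSpace (orbitCoordRep f m) (ψ ∘ ι)) ⧸
      Submodule.comap (highestWeightSpace (orbitCoordRep f m) (ψ ∘ ι)).subtype
        (⨆ p : Weight σ × Weight σ, ⨆ (_ : p.1 + p.2 = (ψ ∘ ι) ∧ p.1 ≠ 0 ∧ p.2 ≠ 0),
          highestWeightSpace (orbitCoordRep f m) p.1 * highestWeightSpace (orbitCoordRep f m) p.2)) ≠ 0 := by
  constructor
  · intro h
    have hψ : HasHighestWeight (orbitCoordRep (rename κ f) m) ψ :=
      ne_bot_of_finrank_quotient_ne_zero _ _ h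
    have hext := extend_comp_eq_of_hasHighestWeight_rename hκ hι hup hψ
    refine ⟨hext, ?_⟩
    rw [← finrank_rename_eq_of_injective κ hκ hι hup hf hf0 (ψ ∘ ι), hext]
    exact h
  · rintro ⟨hext, h⟩
    rw [← hext, finrank_rename_eq_of_injective κ hκ hι hup hf hf0 (ψ ∘ ι)]
    exact h

/-- **Generator counts of a placed form are the own-letter counts** at every occurring weight:
if `ψ` occurs in `ℂ[Δ_m(rename κ f)]` then `γ_ψ(rename κ f) = γ_{ψ∘ι}(f)`. [folklore] -/
theorem finrank_rename_eq_comp_of_hasHighestWeight {κ : σ → τ} (hκ : Function.Injective κ)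
    {ι : σ → τ} (hι : StrictMono ι) (hup : IsUpperSet (Set.range ι)) {f : MvPolynomial σ ℂ} {m : ℕ}
    (hf : f.IsHomogeneous m) (hf0 : f ≠ 0) {ψ : Weight τ}
    (hψ : HasHighestWeight (orbitCoordRep (rename κ f) m) ψ) :
    Module.finrank ℂ (↥(highestWeightSpace (orbitCoordRep (rename κ f) m) ψ) ⧸
      Submodule.comap (highestWeightSpace (orbitCoordRep (rename κ f) m) ψ).subtype
        (⨆ p : Weight τ × Weight τ, ⨆ (_ : p.1 + p.2 = ψ ∧ p.1 ≠ 0 ∧ p.2 ≠ 0),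
          highestWeightSpace (orbitCoordRep (rename κ f) m) p.1 *
            highestWeightSpace (orbitCoordRep (rename κ f) m) p.2)) =
    Module.finrank ℂ (↥(highestWeightSpace (orbitCoordRep f m) (ψ ∘ ι)) ⧸
      Submodule.comap (highestWeightSpace (orbitCoordRep f m) (ψ ∘ ι)).subtype
        (⨆ p : Weight σ × Weight σ, ⨆ (_ : p.1 + p.2 = (ψ ∘ ι) ∧ p.1 ≠ 0 ∧ p.2 ≠ 0),
          highestWeightSpace (orbitCoordRep f m) p.1 * highestWeightSpace (orbitCoordRep f m) p.2)) := by
  conv_lhs => rw [← extend_comp_eq_of_hasHighestWeight_rename hκ hι hup hψ]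
  exact finrank_rename_eq_of_injective κ hκ hι hup hf hf0 (ψ ∘ ι)

end TwoSided

/-! ## 4. The route's block permanent -/

section Per

/-- The route's block placement `(i,j) ↦ (castAdd e i, castAdd e j)` of the `m²` matrix letters
among the `(m+e)²` ones is injective. [folklore] -/
theorem blockEmb_injective (m e : ℕ) :
    Function.Injective fun x : MatIdx m =>
      (toLex (Fin.castAdd e (ofLex x).1, Fin.castAdd e (ofLex x).2) : MatIdx (m + e)) := by
  intro x y hxy
  have h1 := toLex.injective hxy
  rw [Prod.mk.injEq] at h1
  exact ofLex.injective (Prod.ext (Fin.castAdd_injective _ _ h1.1) (Fin.castAdd_injective _ _ h1.2))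

/-- **Generator types of the block permanent are exactly the inherited ones.**  For the final
segment `ι : MatIdx m → MatIdx (m+e)` and ANY weight `ψ` of `GL_{(m+e)²}`: `ψ` is a generator type of
`A(Δ_m[per_m on the top-left m×m block])` iff `ψ = ext_ι(ψ ∘ ι)` and `ψ ∘ ι` is a generator type of
`A(Δ_m[per_m])` (own `m²` letters) — the two-sided form of the route's landed `GenInheritance`
(stmt-ValiantsHypothesis-11659) and of `GammaEquality.finrank_blockPer_eq`. [folklore] -/
theorem blockPer_genType_iff (m e : ℕ) {ι : MatIdx m → MatIdx (m + e)}
    (hι : StrictMono ι) (hup : IsUpperSet (Set.range ι)) (ψ : Weight (MatIdx (m + e))) :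
    Module.finrank ℂ (↥(highestWeightSpace (orbitCoordRep (MvPolynomial.rename (fun ij : Fin m × Fin m => toLex (Fin.castAdd e ij.1, Fin.castAdd e ij.2)) (perPoly (Fin m) ℂ)) m) ψ) ⧸ Submodule.comap (highestWeightSpace (orbitCoordRep (MvPolynomial.rename (fun ij : Fin m × Fin m => toLex (Fin.castAdd e ij.1, Fin.castAdd e ij.2)) (perPoly (Fin m) ℂ)) m) ψ).subtype (⨆ p : Weight (MatIdx (m + e)) × Weight (MatIdx (m + e)), ⨆ (_ : p.1 + p.2 = ψ ∧ p.1 ≠ 0 ∧ p.2 ≠ 0), highestWeightSpace (orbitCoordRep (MvPolynomial.rename (fun ij : Fin m × Fin m => toLex (Fin.castAdd e ij.1, Fin.castAdd e ij.2)) (perPoly (Fin m) ℂ)) m) p.1 * highestWeightSpace (orbitCoordRep (MvPolynomial.rename (fun ij : Fin m × Fin m => toLex (Fin.castAdd e ij.1, Fin.castAdd e ij.2)) (perPoly (Fin m) ℂ)) m) p.2)) ≠ 0 ↔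
    Function.extend ι (ψ ∘ ι) 0 = ψ ∧
    Module.finrank ℂ (↥(highestWeightSpace (orbitCoordRep (MvPolynomial.rename toLex (perPoly (Fin m) ℂ)) m) (ψ ∘ ι)) ⧸ Submodule.comap (highestWeightSpace (orbitCoordRep (MvPolynomial.rename toLex (perPoly (Fin m) ℂ)) m) (ψ ∘ ι)).subtype (⨆ p : Weight (MatIdx m) × Weight (MatIdx m), ⨆ (_ : p.1 + p.2 = (ψ ∘ ι) ∧ p.1 ≠ 0 ∧ p.2 ≠ 0), highestWeightSpace (orbitCoordRep (MvPolynomial.rename toLex (perPoly (Fin m) ℂ)) m) p.1 * highestWeightSpace (orbitCoordRep (MvPolynomial.rename toLex (perPoly (Fin m) ℂ)) m) p.2)) ≠ 0 := by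
  have hf : (rename toLex (perPoly (Fin m) ℂ) : MvPolynomial (MatIdx m) ℂ).IsHomogeneous m := by
    simpa using (perPoly_isHomogeneous (n := Fin m) (k := ℂ)).rename_isHomogeneous
      (f := (toLex : Fin m × Fin m → MatIdx m))
  have hf0 : (rename toLex (perPoly (Fin m) ℂ) : MvPolynomial (MatIdx m) ℂ) ≠ 0 :=
    (map_ne_zero_iff _ (rename_injective _ toLex.injective)).mpr (perPoly_ne_zero (Fin m) ℂ)
  have key := finrank_ne_zero_rename_iff (m := m) (blockEmb_injective m e) hι hup hf hf0 ψ
  rw [rename_rename] at key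
  exact key

end Per

/-! ## 5. Generator flips live on slice weights: `GenFlipThesis ⟺ OwnFlip` -/

section Flip

/-- **`GenFlipThesis` ⟺ the own-variables flip statement.**  The route's deciding crux
`GenFlipThesis` (stmt-ValiantsHypothesis-11653, verbatim) holds iff for every `c, m₀` there is
`m ≥ max(m₀,1)` such that at every size of the window and for the final segment `ι` some weight `χ`
of `GL_{m²}` has `γ_{ext_ι χ}(tr X_n^m) < γ_χ(per_m)` (permanent in its OWN `m²` letters).
`⟸` is the tree's `genFlipThesis_of_ownFlip`; `⟹`: a flip weight `ψ` has `γ_ψ(block per_m) ≠ 0`,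
so `ψ = ext_ι(ψ ∘ ι)` is a slice weight (`blockPer_genType_iff`) and the counts transfer
(`finrank_blockPer_eq`).  In particular no flip sits at a wide weight: the wide regime of K2
(`stub_wideGen` of the line `trace-side-regimes`) cannot serve ANY flip. [folklore] -/
theorem genFlipThesis_iff_ownFlip :
    GenFlipThesis ↔
    (∀ c m₀ : ℕ, ∃ m : ℕ, m₀ ≤ m ∧ 1 ≤ m ∧ ∀ e : ℕ, m + e ≤ 2 ^ ((Nat.log 2 m + c) ^ c) →
      ∀ ι : MatIdx m → MatIdx (m + e), StrictMono ι → IsUpperSet (Set.range ι) →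
        ∃ χ : Weight (MatIdx m),
          Module.finrank ℂ (↥(highestWeightSpace (orbitCoordRep (powFormLex ℂ (m + e) m) m) (Function.extend ι χ 0)) ⧸ Submodule.comap (highestWeightSpace (orbitCoordRep (powFormLex ℂ (m + e) m) m) (Function.extend ι χ 0)).subtype (⨆ p : Weight (MatIdx (m + e)) × Weight (MatIdx (m + e)), ⨆ (_ : p.1 + p.2 = (Function.extend ι χ 0) ∧ p.1 ≠ 0 ∧ p.2 ≠ 0), highestWeightSpace (orbitCoordRep (powFormLex ℂ (m + e) m) m) p.1 * highestWeightSpace (orbitCoordRep (powFormLex ℂ (m + e) m) m) p.2)) <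
          Module.finrank ℂ (↥(highestWeightSpace (orbitCoordRep (MvPolynomial.rename toLex (perPoly (Fin m) ℂ)) m) χ) ⧸ Submodule.comap (highestWeightSpace (orbitCoordRep (MvPolynomial.rename toLex (perPoly (Fin m) ℂ)) m) χ).subtype (⨆ p : Weight (MatIdx m) × Weight (MatIdx m), ⨆ (_ : p.1 + p.2 = χ ∧ p.1 ≠ 0 ∧ p.2 ≠ 0), highestWeightSpace (orbitCoordRep (MvPolynomial.rename toLex (perPoly (Fin m) ℂ)) m) p.1 * highestWeightSpace (orbitCoordRep (MvPolynomial.rename toLex (perPoly (Fin m) ℂ)) m) p.2))) := by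
  refine ⟨fun h c m₀ => ?_, genFlipThesis_of_ownFlip⟩
  obtain ⟨m, hm₀, h1m, hwin⟩ := h c m₀
  refine ⟨m, hm₀, h1m, fun e he ι hι hup => ?_⟩
  obtain ⟨ψ, hψ⟩ := hwin e he
  have hne : Module.finrank ℂ (↥(highestWeightSpace (orbitCoordRep (MvPolynomial.rename (fun ij : Fin m × Fin m => toLex (Fin.castAdd e ij.1, Fin.castAdd e ij.2)) (perPoly (Fin m) ℂ)) m) ψ) ⧸ Submodule.comap (highestWeightSpace (orbitCoordRep (MvPolynomial.rename (fun ij : Fin m × Fin m => toLex (Fin.castAdd e ij.1, Fin.castAdd e ij.2)) (perPoly (Fin m) ℂ)) m) ψ).subtype (⨆ p : Weight (MatIdx (m + e)) × Weight (MatIdx (m + e)), ⨆ (_ : p.1 + p.2 = ψ ∧ p.1 ≠ 0 ∧ p.2 ≠ 0), highestWeightSpace (orbitCoordRep (MvPolynomial.rename (fun ij : Fin m × Fin m => toLex (Fin.castAdd e ij.1, Fin.castAdd e ij.2)) (perPoly (Fin m) ℂ)) m) p.1 * highestWeightSpace (orbitCoordRep (MvPolynomial.rename (fun ij : Fin m ×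 Fin m => toLex (Fin.castAdd e ij.1, Fin.castAdd e ij.2)) (perPoly (Fin m) ℂ)) m) p.2)) ≠ 0 :=
    Nat.ne_zero_of_lt hψ
  obtain ⟨hext, -⟩ := (blockPer_genType_iff m e hι hup ψ).mp hne
  refine ⟨ψ ∘ ι, ?_⟩
  rw [← finrank_blockPer_eq m e hι hup (ψ ∘ ι), hext]
  exact hψ

end Flip

end

end Summit.ValiantsHypothesis.ValiantsHypothesis.Theorems.GenInheritance
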